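import Summits.CriticalPhenomena.PercolationContinuityZ3.Theorems.PercNearOneGluingNoHeavyPcintKernZ4S5Defs
import HarnessLib

/-!
# PCINT lane, kernel check 4/4 of the B2r window certificate `d = 4`, memory 5 (4-step windows, 4096 codes): codes `3072 ≤ c < 4096`

Cell `prim-pcint`, seat `prim-pcint-2` (gen 2).  Collatz–Wielandt rows `10^5 · row ≤ 99999 · DEN · v` for the window codes in
`[3072, 4096)`, by `decide +kernel` in chunks of `128` codes (natural-number arithmetic only; `maxHeartbeats 0`).
Does NOT build on p205010.
-/

namespace Summit.CriticalPhenomena.PercolationContinuityZ3.Theorems.Pcint.Z4S5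

set_option maxHeartbeats 0 in
/-- Rows `3072 ≤ c < 3200` of the certificate hold. [folklore] -/
theorem chk_3072_3200 : WinK.allRange (WinK.rowOKS 4 3 1664 9744 99999 tbl 71055) 3072 3200 = true := by decide +kernel

set_option maxHeartbeats 0 in
/-- Rows `3200 ≤ c < 3328` of the certificate hold. [folklore] -/
theorem chk_3200_3328 : WinK.allRange (WinK.rowOKS 4 3 1664 9744 99999 tbl 71055) 3200 3328 = true := by decide +kernel

set_option maxHeartbeats 0 in
/-- Rows `3328 ≤ c < 3456` of the certificate hold. [folklore] -/
theorem chk_3328_3456 : WinK.allRange (WinK.rowOKS 4 3 1664 9744 99999 tbl 71055) 3328 3456 = true := by decide +kernel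

set_option maxHeartbeats 0 in
/-- Rows `3456 ≤ c < 3584` of the certificate hold. [folklore] -/
theorem chk_3456_3584 : WinK.allRange (WinK.rowOKS 4 3 1664 9744 99999 tbl 71055) 3456 3584 = true := by decide +kernel

set_option maxHeartbeats 0 in
/-- Rows `3584 ≤ c < 3712` of the certificate hold. [folklore] -/
theorem chk_3584_3712 : WinK.allRange (WinK.rowOKS 4 3 1664 9744 99999 tbl 71055) 3584 3712 = true := by decide +kernel

set_option maxHeartbeats 0 in
/-- Rows `3712 ≤ c < 3840` of the certificate hold. [folklore] -/
theorem chk_3712_3840 : WinK.allRange (WinK.rowOKS 4 3 1664 9744 99999 tbl 71055) 3712 3840 = true := by decide +kernel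

set_option maxHeartbeats 0 in
/-- Rows `3840 ≤ c < 3968` of the certificate hold. [folklore] -/
theorem chk_3840_3968 : WinK.allRange (WinK.rowOKS 4 3 1664 9744 99999 tbl 71055) 3840 3968 = true := by decide +kernel

set_option maxHeartbeats 0 in
/-- Rows `3968 ≤ c < 4096` of the certificate hold. [folklore] -/
theorem chk_3968_4096 : WinK.allRange (WinK.rowOKS 4 3 1664 9744 99999 tbl 71055) 3968 4096 = true := by decide +kernel

/-- Rows `3072 ≤ c < 4096` of the certificate hold. [folklore] -/
theorem chkFile_4 : WinK.allRange (WinK.rowOKS 4 3 1664 9744 99999 tbl 71055) 3072 4096 = true :=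
  chk_split (chk_split (chk_split (chk_split (chk_split (chk_split (chk_split chk_3072_3200 chk_3200_3328) chk_3328_3456) chk_3456_3584) chk_3584_3712) chk_3712_3840) chk_3840_3968) chk_3968_4096

end Summit.CriticalPhenomena.PercolationContinuityZ3.Theorems.Pcint.Z4S5
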